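import Literature.Analysis.FluidPDE.Tao2016AveragedNS.SplitCascadeBootstrapTime
import Literature.Analysis.FluidPDE.Tao2016AveragedNS.SplitCascadeSecondBootstrap
import Literature.Analysis.FluidPDE.Tao2016AveragedNS.SplitCascadeSmallScaleOneAbsorbed
import Literature.Analysis.FluidPDE.Tao2016AveragedNS.SplitCascadeNextStateOfWindow
import Literature.Analysis.FluidPDE.Tao2016AveragedNS.SplitCascadeAsymIntegralTotal
import Literature.Analysis.FluidPDE.TaoCascadeReducedClaimLinks
import HarnessLib

/-!
# The split Prop. 6.5: the reduced induction claim (Prop. 6.12♯), pointwise in the datum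

T. Tao, *Finite time blowup for an averaged three-dimensional Navier–Stokes equation*,
arXiv:1402.0290v3, §6.5 Prop. 6.12, §6.6 Props. 6.13–6.15, Cor. 6.14.
HONEST FRAMING: statements about the SPLIT cascade model system; nothing here proves the split
Prop. 6.5 and nothing here concerns the true Navier–Stokes equations.

The pointwise assembly of the ported §6.5–6.7 for ONE datum of the split Prop. 6.5 (hypotheses with
error constant `C₁/2`, all regime / largeness conditions as explicit scalar hypotheses — the
`InRegime` plumbing that discharges them "for `K`, `1/ε`, `n₀` large" is the remaining assembly step):
bootstrap time `T₁` (`SplitCascadeBootstrapTime.lean`), the window certificate on `[0, T₁]`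
(`SplitCascadeRescaledWindowCert.lean`), Prop. 6.13♯ (`SplitCascadeSmallScaleOneAbsorbed.lean`,
`SplitCascadeScaleOneRegime.lean`), Cor. 6.14♯ (`SplitCascadeSecondBootstrap.lean`), Prop. 6.15♯
(`SplitCascadeNextStateOfWindow.lean`), the one-sided (6.109)♯ with the `a`-asymmetry integral bounded by
`SplitCascadeAsymIntegralTotal.lean`, and the tree's `ReducedConclusion.of_nextState`
⇒ `∃ τ₁, ReducedConclusion γ ε₀ K ε n₀ Y F T₁ τ₁ (ã₁(τ₁))` with `γ = 10⁻⁵e^{-K¹⁰/2}`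
(`reducedConclusion_of_profile`).

## References

* T. Tao, arXiv:1402.0290v3, §6.5 Prop. 6.12, §6.6. [`Tao2016AveragedNS`]
-/

noncomputable section

open Set MeasureTheory intervalIntegral

namespace Literature.Analysis.FluidPDE

namespace Tao2016AveragedNS

open TaoCascade hiding ExitTrichotomy
open TaoCascade.ZeroScale hiding Context Setting

section Pointwise

variable {ε₀ K ε C₁ C₂ C₃ : ℝ} {n₀ N : ℤ} {ηp : ℤ → ℝ} {βp : ℕ → ℝ} {τ : ℤ → ℝ}
  {Y : Fin 4 → ℤ → ℝ → ℝ} {W : Fin 3 → ℤ → ℝ → ℝ} {F : ℤ → ℝ → ℝ}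

set_option maxHeartbeats 400000 in
/-- **Prop. 6.12♯ (reduced induction claim), pointwise in the datum**, at the bootstrap time `T₁`.
[cite: Tao2016AveragedNS, §6.5 Prop. 6.12; §6.6 Props. 6.13–6.15, Cor. 6.14] -/
theorem RescaledSplitHypotheses.reducedConclusion_of_profile
    (h : RescaledSplitHypotheses (1 / 10 ^ 5 * Real.exp (-K ^ 10 / 2)) ε₀ K ε (C₁ / 2) C₂ C₃ n₀ N
      ηp βp τ Y W F)
    (hε₀ : 0 < ε₀) (hε₀1 : ε₀ < 1) (hε : 0 < ε) (hε1 : ε ≤ 1) (hC₁ : 0 ≤ C₁) (hC₂ : 0 ≤ C₂)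
    (hC₃ : 0 ≤ C₃) (hN : n₀ ≤ N)
    -- largeness of `K` (depending on `ε₀`, `C₃`)
    (hK18 : (10 : ℝ) ^ 18 ≤ K) (hKε : 10 ^ 8 ≤ ε₀ * K ^ 4) (hKε₀ : (10 : ℝ) ^ 6 ≤ K * ε₀)
    (hKD : 11 * K ^ (-(1 : ℝ) / 4) ≤ 1 / (2 * 10 ^ 5))
    (hκ : 36 * Real.sqrt 2 * K * ((K ^ 15)⁻¹ * (1 + ε₀) ^ (-(999 : ℝ) / 100) * C₃ *
      geomConst ε₀ ((248 : ℝ) / 100)) ≤ 1)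
    (hKa : 24 * ((K ^ 30)⁻¹ * C₃ * geomConst ε₀ ((747 : ℝ) / 100)) ≤ K ^ (-(1 : ℝ) / 4))
    (hKc : 48600 * K ^ 10 * Real.exp (-(188 / 100) * K ^ 10) * K ^ (-(1 : ℝ) / 4) *
      (C₃ * geomConst ε₀ ((741 : ℝ) / 100) + 1) ≤ 1)
    (hKd : K ^ (-(1 : ℝ) / 4) * (3 * C₃ * geomConst ε₀ ((245 : ℝ) / 100) + 1100) < 1 / 100)
    (hKe : Real.exp (3600 * Real.sqrt 2 * (K ^ 14)⁻¹) ≤ 2)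
    (hKf1 : 100 * (54 * Real.sqrt 2) * K ^ (-(1 : ℝ) / 4) * Real.exp (-(94 / 100) * K ^ 10) ≤
      1 / 2 * (K ^ 15)⁻¹)
    -- smallness of `ε` (depending on `K`)
    (hεexp : ε * Real.exp (10 ^ 6 * K ^ 10) ≤ 1)
    -- largeness of `n₀` (depending on everything)
    (hn : C₂ * (1 + ε₀) ^ (-(n₀ : ℝ) / 2) * cumEnergyConst ε₀ C₃ ≤ 1 / 100)
    (hδ1 : 4 * C₁ * (1 + ε₀) ^ (-(n₀ : ℝ) / 2) *
      (Real.exp 1 * (6 * Real.sqrt 2 * K) * cumEnergyConst ε₀ C₃ * C₃ * geomConst ε₀ ((496 : ℝ) / 100)) ≤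
      ε ^ 2 * Real.exp (-K ^ 10) * K ^ (-(1 : ℝ) / 4))
    (hδ2 : 400 * C₁ * (1 + ε₀) ^ (-(n₀ : ℝ) / 2) ≤ ε ^ 2 * Real.exp (-K ^ 10) * K ^ (-(1 : ℝ) / 4))
    (hδ3 : 400 * C₁ * (1 + ε₀) ^ (-(n₀ : ℝ) / 2) ≤ 1 / 2 * (K ^ 15)⁻¹)
    (hδ4 : Real.exp (6 / 100 * K ^ 10) * (4 * C₁ *
      (Real.exp 1 * (6 * Real.sqrt 2 * K) * cumEnergyConst ε₀ C₃ * C₃ * geomConst ε₀ ((496 : ℝ) / 100) +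
        100)) * (1 + ε₀) ^ (-(n₀ : ℝ) / 2) ≤ 1 / 4 * (1 + ε₀) ^ (-(n₀ : ℝ) / 4))
    (hlate : (C₁ + C₂ + (C₂ * (1 + ε₀) ^ (2 : ℝ) * (cumEnergyConst ε₀ C₃ + 100) + C₁) + 1) *
      (1 + ε₀) ^ (-(n₀ : ℝ) / 4) ≤ ε ^ 4 * Real.exp (-10 * K ^ 10))
    -- the profile at the checkpoint and the window level
    (hη0 : ηp 0 ≤ 1 / 10 ^ 3) {ηm : ℝ}
    (hη : ∀ i : Fin 3, |W i (-1) 0| ≤ ηm ∧ |W i 0 0| ≤ ηm ∧ |W i 1 0| ≤ ηm)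
    (hζK : windowLevel ε₀ K ε (C₁ / 2) n₀ ηm ^ 2 ≤ 1 / 4 * (K ^ 20)⁻¹)
    (hsmall : 16 * (K ^ 5 * (1 + ε₀) ^ (2 : ℝ)) * ((ε ^ 2)⁻¹ + ε⁻¹ * K ^ 10 + K + 1) *
      windowLevel ε₀ K ε (C₁ / 2) n₀ ηm ^ 2 ≤ C₁ / 2 * (1 + ε₀) ^ (-(n₀ : ℝ) / 2))
    -- the `a`-asymmetry integral of the fresh shell
    (hδ5 : Real.exp (6 / 100 * K ^ 10) * (6 * ε ^ 2 * Real.exp (-K ^ 10) *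
      ((Real.exp ((6 * (ε + ε ^ 2 + 2 * (ε ^ 2)⁻¹ + ε⁻¹ * K ^ 10) + 36 * K) * Real.sqrt 2 *
            ((K ^ 15)⁻¹ * C₃ * geomConst ε₀ ((248 : ℝ) / 100))) *
          ((4 * Real.sqrt 3 * (C₁ / 2) * (1 + ε₀) ^ (-(n₀ : ℝ) / 2)) *
            ((K ^ 15)⁻¹ * C₃ * geomConst ε₀ ((248 : ℝ) / 100)))) ^ 2 *
          C₃ * geomConst ε₀ ((245 : ℝ) / 100) + 100 * windowLevel ε₀ K ε (C₁ / 2) n₀ ηm ^ 2)) ≤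
      1 / 4 * (1 + ε₀) ^ (-(n₀ : ℝ) / 4)) :
    ∃ τ₁ : ℝ, τ₁ ∈ Icc (0 : ℝ) (T1 ε₀ K Y F) ∧
      ReducedConclusion (1 / 10 ^ 5 * Real.exp (-K ^ 10 / 2)) ε₀ K ε n₀ Y F (T1 ε₀ K Y F) τ₁
        (Y 0 1 τ₁) := by
  have hK6 : (10 : ℝ) ^ 6 ≤ K := le_trans (by norm_num) hK18
  have hK2 : 2 ≤ K := le_trans (by norm_num) hK6
  have hK1 : 1 ≤ K := by linarith
  have hK0 : 0 < K := by linarith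
  have hγ1 : 1 / 10 ^ 5 * Real.exp (-K ^ 10 / 2) ≤ 1 / 10 ^ 5 := by
    have : Real.exp (-K ^ 10 / 2) ≤ 1 := Real.exp_le_one_iff.mpr (by
      have : 0 ≤ K ^ 10 := by positivity
      linarith)
    have h5 : (0 : ℝ) ≤ 1 / 10 ^ 5 := by norm_num
    nlinarith
  have hτ00 : τ (n₀ - N) ≤ 0 := h.tau_init_le hN
  set T₁ := T1 ε₀ K Y F with hT₁def
  have hC₁' : 0 ≤ C₁ / 2 := by linarith
  set ζ := windowLevel ε₀ K ε (C₁ / 2) n₀ ηm with hζdef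
  -- the bootstrap time
  have hBT : IsBootstrapTime ε₀ K Y F T₁ :=
    h.isBootstrapTime_T1_of_profile hε₀ hε₀1 hγ1 hK2 hKε hε hε1 hC₁' hC₂ hC₃ hN hn hη0 hη hζK
  have hT₁mem : T₁ ∈ Icc (0 : ℝ) 100 := ⟨hBT.pos.le, hBT.le_hundred⟩
  have hgood₁ : ∀ t ∈ Icc 0 T₁, GoodAt ε₀ K Y F t := hBT.good
  -- the window on `[0, T₁]`
  have hasym₁ : ∀ t ∈ Icc 0 T₁, ∀ i : Fin 3, |W i (-1) t| ≤ ζ ∧ |W i 0 t| ≤ ζ ∧ |W i 1 t| ≤ ζ :=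
    fun t ht i =>
      ⟨h.absW_le_windowLevel hε₀ hε₀1 hε hK1 hC₁' hτ00 hBT.le_hundred hgood₁ hη ht i (Or.inl rfl),
        h.absW_le_windowLevel hε₀ hε₀1 hε hK1 hC₁' hτ00 hBT.le_hundred hgood₁ hη ht i
          (Or.inr (Or.inl rfl)),
        h.absW_le_windowLevel hε₀ hε₀1 hε hK1 hC₁' hτ00 hBT.le_hundred hgood₁ hη ht i
          (Or.inr (Or.inr rfl))⟩
  have hw : AsymWindow ε₀ K ε C₁ n₀ W T₁ ζ := asymWindow_of_bounds hasym₁ hsmall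
  -- Prop. 6.13♯ absorbed, on `[0, T]` for `T ≤ T₁` with `∫₀^T ã₁² ≤ K^{-1/4}`
  have h613 : ∀ T ∈ Icc 0 T₁, (∫ s in (0 : ℝ)..T, Y 0 1 s ^ 2) ≤ K ^ (-(1 : ℝ) / 4) →
      ∀ t ∈ Icc 0 T,
        |Y 1 1 t| ≤ 11 * K ^ (-(1 : ℝ) / 4) * ε ∧
        |Y 2 1 t| + |W 1 1 t| ≤ K ^ (-(1 : ℝ) / 4) * Real.exp (-K ^ 10 / 2) * ε ^ 2 ∧
        -(1 / 2 * (1 + ε₀) ^ (-(n₀ : ℝ) / 4) +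
          Real.exp (6 / 100 * K ^ 10) *
            ∫ s in (τ (n₀ - N))..t, (1 + ε₀) ^ ((5 : ℝ) / 2) * ε ^ 2 * Real.exp (-K ^ 10) * W 0 1 s ^ 2) ≤
          Y 2 1 t ∧
        |Y 3 1 t| < 1 / 2 * (K ^ 10)⁻¹ := by
    intro T hT hP t ht
    have hδ4' : Real.exp (6 / 100 * K ^ 10) * (4 * C₁ *
        (Real.exp 1 * (6 * Real.sqrt 2 * K) * cumEnergyConst ε₀ C₃ * C₃ * geomConst ε₀ ((496 : ℝ) / 100) +
          100)) * (1 + ε₀) ^ (-(n₀ : ℝ) / 2) ≤ 1 / 2 * (1 + ε₀) ^ (-(n₀ : ℝ) / 4) := by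
      have : 0 ≤ (1 + ε₀) ^ (-(n₀ : ℝ) / 4) := (Real.rpow_pos_of_pos (by linarith) _).le
      linarith only [hδ4, this]
    exact h.smallScaleOne_absorbed hε₀ hε₀1 hK2 hε hε1 hC₁ hC₃ hN hκ hKa hKc hKd hKe hKf1 hδ1 hδ2 hδ3
      hδ4' ⟨hT.1, hT.2.trans hBT.le_hundred⟩ (fun s hs => hgood₁ s ⟨hs.1, hs.2.trans hT.2⟩) hP hw hT.2 ht
  -- Cor. 6.14♯: the second bootstrap time
  have hexit : F (-1) T₁ = (K ^ 10)⁻¹ * (1 + ε₀) ^ ((2 : ℝ) / 10) ∨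
      |Y 3 1 T₁| = 1 / 2 * (K ^ 10)⁻¹ ∨ T₁ = 100 := by
    have e : ((2 : ℝ) / 10) = (1 : ℝ) / 5 := by norm_num
    rw [e]; exact hBT.exit
  have h13d : ∀ T ∈ Icc 0 T₁, (∫ t in (0 : ℝ)..T, Y 0 1 t ^ 2) ≤ K ^ (-(1 : ℝ) / 4) →
      |Y 3 1 T| < 1 / 2 * (K ^ 10)⁻¹ := fun T hT hint =>
    (h613 T hT hint T ⟨hT.1, le_rfl⟩).2.2.2
  obtain ⟨T₂, hT₂, hint, hex⟩ := h.exists_second_bootstrap_time hN hK0 hT₁mem hexit h13d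
  have hT₂mem : T₂ ∈ Icc (0 : ℝ) 100 := ⟨hT₂.1, hT₂.2.trans hBT.le_hundred⟩
  have hgood₂ : ∀ t ∈ Icc 0 T₂, GoodAt ε₀ K Y F t := fun t ht => hgood₁ t ⟨ht.1, ht.2.trans hT₂.2⟩
  have hb13 := h613 T₂ hT₂ (hint T₂ ⟨hT₂.1, le_rfl⟩)
  -- `SmallModes K ε 11` on `[0, T₂]`
  have hsm : SmallModes K ε 11 Y T₂ := by
    refine ⟨fun t ht => (hb13 t ht).1, fun t ht => ?_⟩
    have hc := (hb13 t ht).2.1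
    have hc' : |Y 2 1 t| ≤ K ^ (-(1 : ℝ) / 4) * Real.exp (-K ^ 10 / 2) * ε ^ 2 :=
      le_trans (le_add_of_nonneg_right (abs_nonneg _)) hc
    refine hc'.trans ?_
    have hx : K ^ (-(1 : ℝ) / 4) ≤ 11 :=
      (Real.rpow_le_one_of_one_le_of_nonpos hK1 (by norm_num)).trans (by norm_num)
    have h0 : 0 ≤ Real.exp (-K ^ 10 / 2) * ε ^ 2 := by positivity
    calc K ^ (-(1 : ℝ) / 4) * Real.exp (-K ^ 10 / 2) * ε ^ 2
        = K ^ (-(1 : ℝ) / 4) * (Real.exp (-K ^ 10 / 2) * ε ^ 2) := by ring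
      _ ≤ 11 * (Real.exp (-K ^ 10 / 2) * ε ^ 2) := mul_le_mul_of_nonneg_right hx h0
      _ = 11 * Real.exp (-K ^ 10 / 2) * ε ^ 2 := by ring
  -- Prop. 6.15♯ at `T₂`
  have hasym₂ : ∀ t ∈ Icc 0 T₂, ∀ i : Fin 3, |W i (-1) t| ≤ ζ ∧ |W i 0 t| ≤ ζ ∧ |W i 1 t| ≤ ζ :=
    fun t ht i => hasym₁ t ⟨ht.1, ht.2.trans hT₂.2⟩ i
  obtain ⟨τ₁, hτ₁, hns⟩ := h.nextState_of_window hε₀ hε₀1 hε hε1 hC₁ hC₂ hC₃ hN hK18 hKε₀ hεexp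
    hlate hT₂mem hgood₂ hsm hasym₂ hsmall hex
  -- the levels at `τ₁`
  have hτ₁' : τ₁ ∈ Icc 0 T₂ := ⟨by linarith [hτ₁.1], hτ₁.2⟩
  obtain ⟨hb, hc, -, -⟩ := hb13 τ₁ hτ₁'
  have hc' : |Y 2 1 τ₁| ≤ K ^ (-(1 : ℝ) / 4) * Real.exp (-K ^ 10 / 2) * ε ^ 2 :=
    le_trans (le_add_of_nonneg_right (abs_nonneg _)) hc
  -- the `a`-asymmetry integral at `τ₁`
  have hζW : ∀ s ∈ Icc 0 T₁, |W 0 1 s| ≤ ζ := fun s hs => (hw.asym s hs 0).2.2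
  have hI := h.asym_integral_total_le hε₀ hε₀1 hK1 hε (by linarith : 0 ≤ C₁ / 2) hC₃ hN
    hBT.le_hundred hζW (t := τ₁) ⟨hτ₁'.1, hτ₁'.2.trans hT₂.2⟩
  have hcge : -(1 / 2 * (1 + ε₀) ^ (-(n₀ : ℝ) / 4)) ≤ Y 2 1 τ₁ := by
    -- the raw one-sided bound of `prop613_regime` at `T₂`
    have hq1 : (1 : ℝ) ≤ 1 + ε₀ := by linarith
    have hE1 : ∀ s ∈ Icc 0 T₂, F 1 s ≤ 1 := fun s hs =>
      h.energy_le_one_of_goodAt hε₀ hε₀1 hK2 hN hs.1 (hgood₂ s hs) (Or.inr (Or.inr rfl))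
    have hE2 : ∀ s ∈ Icc 0 T₂, F 2 s ≤ (K ^ 30)⁻¹ := by
      intro s hs
      have ha := (hgood₂ s hs).after 1 le_rfl
      have e1 : (1 : ℤ) + ((1 : ℕ) : ℤ) = 2 := by norm_num
      rw [e1] at ha
      have hle : (1 + ε₀) ^ (-(10 : ℝ) * ((1 : ℕ) : ℝ)) ≤ 1 :=
        Real.rpow_le_one_of_one_le_of_nonpos hq1 (by norm_num)
      calc F 2 s ≤ (K ^ 30)⁻¹ * (1 + ε₀) ^ (-(10 : ℝ) * ((1 : ℕ) : ℝ)) := ha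
        _ ≤ (K ^ 30)⁻¹ * 1 := mul_le_mul_of_nonneg_left hle (by positivity)
        _ = (K ^ 30)⁻¹ := mul_one _
    obtain ⟨-, -, hraw, -⟩ := h.prop613_regime hε₀ hε₀1 hK1 hε hε1 hC₁ hC₃ hN hκ hKa hKc hKd hδ1 hδ2
      hT₂.1 hT₂mem.2 hE1 hE2 (hint T₂ ⟨hT₂.1, le_rfl⟩) hw hT₂.2 hτ₁'
    have hE0 : 0 ≤ Real.exp (6 / 100 * K ^ 10) := (Real.exp_pos _).le
    have h1 := mul_le_mul_of_nonneg_left hI hE0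
    have e : Real.exp (6 / 100 * K ^ 10) * (4 * C₁ * (1 + ε₀) ^ (-(n₀ : ℝ) / 2) *
        (Real.exp 1 * (6 * Real.sqrt 2 * K) * cumEnergyConst ε₀ C₃ * C₃ * geomConst ε₀ ((496 : ℝ) / 100) +
          100)) = Real.exp (6 / 100 * K ^ 10) * (4 * C₁ *
        (Real.exp 1 * (6 * Real.sqrt 2 * K) * cumEnergyConst ε₀ C₃ * C₃ * geomConst ε₀ ((496 : ℝ) / 100) +
          100)) * (1 + ε₀) ^ (-(n₀ : ℝ) / 2) := by ring
    rw [mul_add, e] at hraw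
    linarith only [hraw, h1, hδ5, hδ4]
  refine ⟨τ₁, ⟨hτ₁'.1, hτ₁'.2.trans hT₂.2⟩, ReducedConclusion.of_nextState hε₀ hε₀1 hK0 hε hT₂.2 hτ₁
    hns hb hc' hcge ?_ ?_ le_rfl⟩
  · calc 11 * K ^ (-(1 : ℝ) / 4) * ε ≤ 1 / (2 * 10 ^ 5) * ε := mul_le_mul_of_nonneg_right hKD hε.le
      _ = ε / (2 * 10 ^ 5) := by ring
  · have h1 : K ^ (-(1 : ℝ) / 4) ≤ 1 / (2 * 10 ^ 5) := by
      have : 0 ≤ K ^ (-(1 : ℝ) / 4) := (Real.rpow_pos_of_pos hK0 _).le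
      linarith only [hKD, this]
    have h2 : 0 ≤ Real.exp (-K ^ 10 / 2) * ε ^ 2 := by positivity
    calc K ^ (-(1 : ℝ) / 4) * Real.exp (-K ^ 10 / 2) * ε ^ 2
        = K ^ (-(1 : ℝ) / 4) * (Real.exp (-K ^ 10 / 2) * ε ^ 2) := by ring
      _ ≤ 1 / (2 * 10 ^ 5) * (Real.exp (-K ^ 10 / 2) * ε ^ 2) := mul_le_mul_of_nonneg_right h1 h2
      _ = 1 / 10 ^ 5 * Real.exp (-K ^ 10 / 2) * ε ^ 2 / 2 := by ring

end Pointwise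

end Tao2016AveragedNS

end Literature.Analysis.FluidPDE
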